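import Summits.CriticalPhenomena.PercolationContinuityZ3.Theorems.Transplant.FKConnectivityAllQTwoTree
import HarnessLib

/-!
# Connectivity correlation inequalities for `φ_{w,q}`, every `q > 0` — TWO-SUMS, file 5 (DEFINITION): the class of edge sets
# GLUED FROM 2-TREES AND `K₄`'s ALONG SHARED PAIRS

Definitions file (`--supports stmt-CriticalPhenomena-4575`), FK sub-lane `prim-bschramm-fk-1` (gen 6) of the post-continuity
programme; builds on p205010 (kernel theorem, internal audit signed; external expert review pending).  No named facts, no sorries,
nothing probabilistic: this file only fixes the SYNTAX of a class of supports; the sibling `…TwoSumClass.lean` proves that every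
member carries edge-negatively associated random-cluster measures `φ_{w,q}` for all weights and all `0 < q ≤ 1` (fk-1 g5's 2-tree
theorem and `K₄` certificate, closed up under Wagner's two-sum theorem `FK.edgeNegCorrSupp_twoSum`, file `…TwoSum.lean`).

* `FK.IsTwoTreeK4Glued E` — the least class of edge sets `E ⊆ Sym2 V` containing every 2-tree (`FK.IsTwoTree`, hence — up to
  subsets — every finite series–parallel graph) and the six pairs of every `K₄` on four distinct vertices, and closed under
  PARALLEL CONNECTION along a shared pair: if `E₁, E₂` are in the class, both contain the pair `st` (`s ≠ t`), have no other pair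
  in common, and their spanned vertex sets meet only inside `{s, t}`, then `E₁ ∪ E₂` is in the class.  (Wagner 2008, §5.3: "the
  class of Potts–Rayleigh matroids contains all uniform matroids and `K₄` and is closed by taking duals, minors and two-sums";
  graph case, with the two-sum realised as parallel connection followed — if desired — by deletion, i.e. a subset.)  Informally the
  subsets of members are the finite simple graphs all of whose 3-connected pieces are `K₄`'s (no `W₄` minor); that identification
  is not formalised and not used.
[cite: Wagner2006, Thm. 5.8(d), §5.3 (pp. 14–15)] [cite: Grimmett2006, §3.9 (pp. 63–64)]
-/

namespace Summit.CriticalPhenomena.PercolationContinuityZ3.Theorems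

namespace FK

variable {V : Type*}

/-- **Edge sets glued from 2-trees and `K₄`'s**: the least class of edge sets containing the 2-trees (`IsTwoTree`) and the
`K₄`'s (six pairs on four distinct vertices) and closed under parallel connection along a shared pair `st` (both parts contain
`st`, share no other pair, and their spanned vertex sets meet only in `{s, t}`).  Graph case of Wagner's stock of Potts–Rayleigh
matroids (uniform matroids, `K₄`; duals, minors, two-sums). [cite: Wagner2006, Thm. 5.8(d), §5.3 (pp. 14–15)] -/
inductive IsTwoTreeK4Glued : Set (Sym2 V) → Prop
  /-- every 2-tree is in the class -/
  | twoTree {T : Set (Sym2 V)} (hT : IsTwoTree T) : IsTwoTreeK4Glued T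
  /-- every `K₄` on four distinct vertices is in the class -/
  | k4 {x y z t : V} (hxy : x ≠ y) (hxz : x ≠ z) (hxt : x ≠ t) (hyz : y ≠ z) (hyt : y ≠ t) (hzt : z ≠ t) :
      IsTwoTreeK4Glued {s(x, y), s(x, z), s(x, t), s(y, z), s(y, t), s(z, t)}
  /-- parallel connection along the shared pair `st` -/
  | glue {E₁ E₂ : Set (Sym2 V)} {s t : V} (h₁ : IsTwoTreeK4Glued E₁) (h₂ : IsTwoTreeK4Glued E₂) (hst : s ≠ t)
      (hst₁ : s(s, t) ∈ E₁) (hst₂ : s(s, t) ∈ E₂) (hd : Disjoint (E₁ \ {s(s, t)}) E₂)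
      (hV : ∀ z : V, (∃ e ∈ E₁, z ∈ e) → (∃ e ∈ E₂, z ∈ e) → z = s ∨ z = t) :
      IsTwoTreeK4Glued (E₁ ∪ E₂)

end FK

end Summit.CriticalPhenomena.PercolationContinuityZ3.Theorems
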